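import Literature.AnabelianGeometry.AbsoluteAnabelian.DiagramCores
import Literature.IUT.HodgeTheaters.ThetaHodgeTheatersRemarksC
import HarnessLib

/-!
# [IUTchI] Remark 3.9.1: the étale-picture has `𝒟⊢_v` as a CORE ([AbsTopIII] Def. 3.5 (iii))

S. Mochizuki, *Inter-universal Teichmüller theory I*, §3, Remark 3.9.1, kurims manuscript (May 2020)
p. 92 [claim: Mochizuki2012, status: disputed]: "If one formulates things relative to the language
of [AbsTopIII], Definition 3.5, then `⁽⁻⁾𝒟⊢_v` constitutes a core."  The étale-picture of Cor. 3.9 (i)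
(Fig. 3.2, p. 91) is a STAR: vertices the `ⁿ𝒟_v` (`n ∈ ℤ`), no arrows among them (the Θ-links of
the Frobenius-picture are poly-isomorphisms, not functors), and from each `ⁿ𝒟_v` the relationship
"— —" to the single centre `𝒟⊢_v` (for `v ∈ V̲^non`: `𝒟_v = B^temp(X̲̲_v)⁰ → 𝒟⊢_v = B(K_v)⁰`, Ex. 3.2
(i), the natural functor; for `v ∈ V̲^arc`: passage to the underlying object of `TM⊢`, Ex. 3.4 (ii)).

DISCHARGE.  Using abc-iut-L4-t2's honest typing of [AbsTopIII] Def. 3.5 (i)–(iii)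
(`DiagramOfCategories`, `Observable`, `Observable.IsCore`) and abc-iut-L4-t5's construction
`DiagramOfCategories.coreObservable` / `isCore_coreObservable` (structure functors over a fixed
category yield a core as soon as every vertex reaches the observation vertex), we build, for ANY
family of categories `A n` (the `ⁿ𝒟_v`) with functors `N n : A n ⥤ B` to a fixed category `B`
(`𝒟⊢_v`), the étale-picture diagram and PROVE that the observable constituted by `B` and the edges
`N n` IS A CORE (`etaleObservable_isCore`).  This instantiates the placeholder slot
`S3Local.Rmk391IsCore` of `ThetaHodgeTheatersRemarksC.lean` on an honest `S3Local.CoreContext`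
(`rmk391IsCore_etalePicture`).  With abc-iut-L5-t2's `HodgeTheaterModel M` (Def. 3.6 interface,
`ThetaHodgeTheaters.lean`, pending) one takes `ι := ℤ`, `A n := M.BaseFull v`, `B := M.Base v`,
`N n := M.dashOfBase v` — a one-line specialisation left to the first file that can import both
(TODO-merge:abc-iut-L5-t2 `HodgeTheaterModel`).  The sentences "this core is essentially the
mono-analytic core of [AbsTopIII] §5" and "`⊢` abbreviates mono-analytic" remain prose (noted in
`ThetaHodgeTheatersRemarksC.lean`).  Nothing here takes a side on the disputed step of [IUTchIII];
the content is elementary category theory over the two cited interfaces.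
-/

namespace Literature.IUT.HodgeTheaters

open CategoryTheory Quiver Literature.AnabelianGeometry.AbsoluteAnabelian

universe v u w

namespace EtalePictureCore

/-- The label set of the étale-picture (Cor. 3.9 (i): `n ∈ ℤ`; here any `ι`) as an oriented graph
with NO arrows among the labels. [claim: Mochizuki2012, status: disputed] -/
def Labels (ι : Type w) : Type w := ι

/-- No arrows among the `ⁿ𝒟_v` in the étale-picture (Fig. 3.2). [claim: Mochizuki2012, status: disputed] -/
instance (ι : Type w) : Quiver.{v} (Labels ι) := ⟨fun _ _ => PEmpty.{v+1}⟩

variable {ι : Type w} (A : ι → Type u) [∀ n, Category.{v} (A n)] (B : Type u) [Category.{v} B]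
  (N : ∀ n, A n ⥤ B)

/-- The étale-picture as a diagram of categories on the label graph: the category `ⁿ𝒟_v := A n` at
the label `n`, no functors among them (Cor. 3.9 (i), Fig. 3.2). [claim: Mochizuki2012, status: disputed] -/
def diagram : DiagramOfCategories.{v, u, w} (Labels ι) where
  obj n := A n
  map e := PEmpty.elim e

/-- The shape of the étale-picture observable: exactly one observation edge "— —" from each `ⁿ𝒟_v`
to the centre, no telecore edges. [claim: Mochizuki2012, status: disputed] -/
def shape : ExtShape.{v} (Labels ι) where
  I _ := PUnit.{v+1}
  J _ := PEmpty.{v+1}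

/-- The extension data: the centre category `𝒟⊢_v := B` and the functors `ⁿ𝒟_v ⥤ 𝒟⊢_v` along the
observation edges (Ex. 3.2 (i) / 3.4 (ii): `𝒟_v → 𝒟⊢_v`). [claim: Mochizuki2012, status: disputed] -/
def ext : (diagram A).ExtData (shape (ι := ι)) where
  S := B
  obsMap {n} _ := N n
  telMap j := PEmpty.elim j

/-- Every `ⁿ𝒟_v` lies over `𝒟⊢_v` through `N n` (the structure functors; there are no diagram edges
to make compatible). [claim: Mochizuki2012, status: disputed] -/
def over : (diagram A).OverData B where
  N n := N n
  μ e := PEmpty.elim e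

/-- **The étale-picture observable** "`⁽⁻⁾𝒟⊢_v` with the relationships — — to the `ⁿ𝒟_v`"
(Cor. 3.9 (i), Fig. 3.2), as an observable on the étale-picture diagram in the sense of [AbsTopIII]
Def. 3.5 (iii) (abc-iut-L4-t5's `coreObservable`). [claim: Mochizuki2012, status: disputed] -/
noncomputable def etaleObservable : (diagram A).Observable :=
  (diagram A).coreObservable shape (fun _ => inferInstanceAs (IsEmpty PEmpty)) (ext A B N)
    (over A B N) (fun _ _ => Iso.refl _)

/-- **[IUTchI] Remark 3.9.1** (p. 92) — "`⁽⁻⁾𝒟⊢_v` constitutes a core" — PROVED for every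
realisation of the étale-picture as categories `ⁿ𝒟_v` with functors to `𝒟⊢_v`: the étale-picture
observable is a core in the sense of [AbsTopIII] Def. 3.5 (iii). [claim: Mochizuki2012, status: disputed] -/
theorem etaleObservable_isCore : (etaleObservable A B N).IsCore :=
  (diagram A).isCore_coreObservable shape (fun _ => inferInstanceAs (IsEmpty PEmpty)) (ext A B N)
    (over A B N) (fun _ _ => Iso.refl _)
    (fun n => ⟨(Path.nil : Path ((shape (ι := ι)).base n) _).cons
      (show (shape (ι := ι)).base n ⟶ (shape (ι := ι)).obs from PUnit.unit)⟩)

/-- The honest instantiation of the Rmk 3.9.1 container of `ThetaHodgeTheatersRemarksC.lean`: the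
observables on the étale-picture diagram, the core predicate of [AbsTopIII] Def. 3.5 (iii), and the
étale-picture observable `⁽⁻⁾𝒟⊢_v`. [claim: Mochizuki2012, status: disputed] -/
noncomputable def coreContext : S3Local.CoreContext :=
  ⟨(diagram A).Observable, fun S => DiagramOfCategories.Observable.IsCore (diagram A) S,
    etaleObservable A B N⟩

/-- **[IUTchI] Remark 3.9.1**, discharged on the honest instantiation: the slot
`S3Local.Rmk391IsCore` HOLDS for the étale-picture context of any family `ⁿ𝒟_v ⥤ 𝒟⊢_v`
(for abc-iut-L5-t2's `HodgeTheaterModel M`: `A n := M.BaseFull v`, `B := M.Base v`,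
`N n := M.dashOfBase v`). PROVED. [claim: Mochizuki2012, status: disputed] -/
theorem rmk391IsCore_etalePicture : S3Local.Rmk391IsCore (coreContext A B N) :=
  etaleObservable_isCore A B N

end EtalePictureCore

end Literature.IUT.HodgeTheaters
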